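import Summits.NavierStokesRegularity.FluidComputer.SymmetryPlaneFluxLaw
import Literature.Analysis.FluidPDE.NSEnstrophyPersistenceForced
import HarnessLib

/-!
# Symmetry-plane flux law, II — the normal vorticity on a mirror plane of a classical
# Navier–Stokes / Euler flow obeys a planar continuity equation; the flux through a FIXED plane
# region changes only by edge transport, viscous diffusion and the curl of the force

HONEST FRAMING (cell `ns-blowup`, lane W, seat `ns-blowup-wind`; human ruling D-0035). WHAT THIS
IS NOT: not a statement about Navier–Stokes blow-up in either direction and not about any
particular flow: the classical vorticity equation restricted to a symmetry plane, kernel-checked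
because it is the EXACT half of the lane-W mechanism word of record (RESULT «P-WIND-NF» §4 M2:
*material crossing points of the antipode plane are expelled, so the flux that re-appears in the
fixed diameter is viscous bridging `ν ∂²_z ω_z`, not transport*). Kinematics in the companion
`SymmetryPlaneFluxLaw.lean` (parity on the mirror plane; Green's formula on a plane rectangle).

For a classical solution `(u, p)` of the Navier–Stokes system with ANY viscosity `ν` (Euler:
`ν = 0`) and force `f` on `ℝ³ × S` (tree predicate
`Literature.Analysis.FluidPDE.IsClassicalNSSolutionOn S ν f u p`; `S` of unique differentiability,
`S ⊆ closure (interior S)`) whose velocity slices are mirror-equivariant,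
`u(s) ∘ σᵢ = σᵢ ∘ u(s)` (`σᵢ = reflC i`):
* `mirrorPlane_vorticity_eq` — at every point of the mirror plane `{xᵢ = 0}` **the normal
  vorticity obeys the planar continuity equation with viscous and force sources**,
  `∂ₜωᵢ = ν ∑ⱼ∂ⱼ∂ⱼωᵢ − ∑_{j≠i} ∂ⱼ(uⱼωᵢ) + (curl f)ᵢ`, `ω = curl u` (from the tree's
  differentiated vorticity equation `IsClassicalNSSolutionOn.vorticity_transport_forced` with the
  empty word, `ωᵢ = Ω_{i+1,i+2}` (`curl_apply_eq_vortComp`), and the parity facts `uᵢ = 0`,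
  `∂_{i+1}uᵢ = ∂_{i+2}uᵢ = 0` on the plane; incompressibility is not even used for this form);
* `setIntegral_mirrorPlane_vorticity_eq` — integrated over a fixed plane rectangle
  `R = P([a₁,b₁]×[a₂,b₂])`, **the flux law**
  `∫_R ∂ₜωᵢ = ν ∫_R ∑ⱼ∂ⱼ∂ⱼωᵢ − ∮_{∂R} ωᵢ (u · n_out) + ∫_R (curl f)ᵢ`,
  the edge term being `[∫ u_{i+2}ωᵢ ds]_{t=a₂}^{t=b₂} + [∫ u_{i+1}ωᵢ dt]_{s=a₁}^{s=b₁}`.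
Read for the cell: apart from viscous diffusion (whose `j = i` term `ν∂ᵢ∂ᵢωᵢ` is the «bridging»
term of the lane-W memo) and the force, the normal-vorticity content of a fixed region of a
symmetry plane changes only by transport across its edge by material points of the invariant
plane; where those points leave and `ωᵢ` is co-signed on the edge
(`SymmetryPlaneFluxLaw.setIntegral_sum_pderiv_mul_nonneg_of_outflow`) the inviscid unforced budget
is `≤ 0`, so any gain of co-signed flux through the fixed region is viscous — the kinematic content
of census token (i′) «RECONNECTIVE TRANSFER-ONLY» and of the 19178 clock rider «a level-to-level
hand-over in this class must budget a viscous reconnection, not a transport» (MODEL evidence of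
record on `stmt-NavierStokesRegularity-19178`; nothing here depends on MODEL numbers).
All proved; 0 `sorry`; no definitions, no named facts. References: Majda–Bertozzi 2002 §1.4
(1.33); Doering–Gibbon 1995 §6.2 (6.2.8) (the forced vorticity equation, as cited by the tree).
-/

noncomputable section

open MeasureTheory Set Function
open scoped BigOperators

namespace Summit.NavierStokesRegularity.FluidComputer.SymmetryPlaneFluxLaw

open Literature.Analysis.FluidPDE

/-! ### §4 Classical Navier–Stokes / Euler solutions with mirror-equivariant slices -/

section Solutions

open scoped ContDiff

variable {S : Set ℝ} {ν : ℝ} {f u : ℝ → EuclideanSpace ℝ (Fin 3) → EuclideanSpace ℝ (Fin 3)}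
  {p : ℝ → EuclideanSpace ℝ (Fin 3) → ℝ}

/-- A sum over `Fin 3` started at `i`: `∑ⱼ φ j = φ i + φ (i+1) + φ (i+2)`. -/
theorem sum_univ_fin_three_rot (φ : Fin 3 → ℝ) (i : Fin 3) :
    ∑ j, φ j = φ i + φ (i + 1) + φ (i + 2) := by
  rw [← Finset.add_sum_erase _ _ (Finset.mem_univ i), sum_univ_erase_fin_three, add_assoc]

/-- **The curl in the tree's component vocabulary**: `(curl v)ᵢ = Ω_{i+1, i+2}(v)`
(`vortComp v k l = ∂ₖvₗ − ∂ₗvₖ`, indices mod 3), for `v` differentiable at `x`. -/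
theorem curl_apply_eq_vortComp {v : EuclideanSpace ℝ (Fin 3) → EuclideanSpace ℝ (Fin 3)}
    {x : EuclideanSpace ℝ (Fin 3)} (hv : DifferentiableAt ℝ v x) (i : Fin 3) :
    curl v x i = vortComp v (i + 1) (i + 2) x := by
  have hc : ∀ k l : Fin 3, fderiv ℝ v x (EuclideanSpace.single k 1) l = pderiv k (fun y => v y l) x :=
    fun k l => by rw [euclidean_fderiv_apply_comp hv]; rfl
  fin_cases i <;> simp [curl, vortComp, hc]

/-- **The normal vorticity on a mirror plane obeys a planar continuity equation (with viscous and
force sources).** Let `(u, p)` be a classical solution of the Navier–Stokes system with viscosity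
`ν` (any real `ν`; `ν = 0` is Euler) and force `f` on `ℝ³ × S`, `S` a time set of unique
differentiability contained in the closure of its interior, whose velocity slices are
mirror-equivariant, `u(s) ∘ σᵢ = σᵢ ∘ u(s)` for `s ∈ S`. Then at every `t ∈ S` and every point `x`
of the mirror plane `{xᵢ = 0}`:
`∂ₜ ωᵢ = ν ∑ⱼ ∂ⱼ∂ⱼ ωᵢ − ∑_{j ≠ i} ∂ⱼ (uⱼ ωᵢ) + (curl f)ᵢ`, `ω = curl u`.
Proof: the tree's vorticity transport identity `IsClassicalNSSolutionOn.vorticity_transport_forced`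
(empty word, component `Ω_{i+1,i+2} = ωᵢ`) and the parity facts of §1 (`uᵢ = 0` and
`∂_{i+1} uᵢ = ∂_{i+2} uᵢ = 0` on the plane); incompressibility is not even needed for this form. -/
theorem mirrorPlane_vorticity_eq
    {i : Fin 3} (h : IsClassicalNSSolutionOn S ν f u p) (hS : UniqueDiffOn ℝ S)
    (hcl : S ⊆ closure (interior S))
    (hsym : ∀ s ∈ S, ∀ x, u s (reflC i x) = reflC i (u s x))
    {t : ℝ} (ht : t ∈ S) {x : EuclideanSpace ℝ (Fin 3)} (hx : x i = 0) :
    Literature.Analysis.FluidPDE.timeDerivWithin S (fun s y => curl (u s) y i) t x =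
      ν * ∑ j, pderiv j (pderiv j fun y => curl (u t) y i) x -
        ∑ j ∈ Finset.univ.erase i, pderiv j (fun y => u t y j * curl (u t) y i) x +
        curl (f t) x i := by
  have hki : i + 1 ≠ i := by fin_cases i <;> decide
  have hli : i + 2 ≠ i := by fin_cases i <;> decide
  have hu : ∀ {s}, s ∈ S → ContDiff ℝ ∞ (u s) := fun hs => h.contDiff_velocity hs
  have hU : ∀ j, ContDiff ℝ ∞ fun y => u t y j := fun j => h.contDiff_comp ht j
  have hUd : ∀ j, Differentiable ℝ fun y => u t y j := fun j => (hU j).differentiable (by simp)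
  have hdU : ∀ j m, ContDiff ℝ ∞ (pderiv m fun y => u t y j) := fun j m => contDiff_pderiv (hU j) m
  have hdUd : ∀ j m, Differentiable ℝ (pderiv m fun y => u t y j) := fun j m =>
    (hdU j m).differentiable (by simp)
  -- `ωᵢ = Ω_{i+1,i+2}` on every slice, and for the force
  have hcv : ∀ s ∈ S, ∀ y, curl (u s) y i = vortComp (u s) (i + 1) (i + 2) y := fun s hs y =>
    curl_apply_eq_vortComp (((hu hs).differentiable (by simp)) y) i
  have hΩ : (fun y => curl (u t) y i) = vortComp (u t) (i + 1) (i + 2) := funext (hcv t ht)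
  have hF : curl (f t) x i = vortComp (f t) (i + 1) (i + 2) x :=
    curl_apply_eq_vortComp (((h.contDiff_force hS ht).differentiable (by simp)) x) i
  have hT : Literature.Analysis.FluidPDE.timeDerivWithin S (fun s y => curl (u s) y i) t x =
      Literature.Analysis.FluidPDE.timeDerivWithin S (fun s y => vortComp (u s) (i + 1) (i + 2) y) t x :=
    timeDerivWithin_congr_on hcv ht x
  -- regularity of `Ω`
  have hΩC : ContDiff ℝ ∞ (vortComp (u t) (i + 1) (i + 2)) := (hdU (i + 2) (i + 1)).sub (hdU (i + 1) (i + 2))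
  have hΩd : Differentiable ℝ (vortComp (u t) (i + 1) (i + 2)) := hΩC.differentiable (by simp)
  -- product rules
  have hexp : ∀ a j b, pderiv a (fun y => u t y j * pderiv j (fun z => u t z b) y) x =
      pderiv a (fun y => u t y j) x * pderiv j (fun z => u t z b) x +
        u t x j * pderiv a (pderiv j fun z => u t z b) x := by
    intro a j b
    rw [pderiv_mul (hUd j) (hdUd b j)]
  have hexp2 : ∀ j, pderiv j (fun y => u t y j * vortComp (u t) (i + 1) (i + 2) y) x =
      pderiv j (fun y => u t y j) x * vortComp (u t) (i + 1) (i + 2) x +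
        u t x j * pderiv j (vortComp (u t) (i + 1) (i + 2)) x := by
    intro j
    rw [pderiv_mul (hUd j) hΩd]
  have hΩx : vortComp (u t) (i + 1) (i + 2) x =
      pderiv (i + 1) (fun y => u t y (i + 2)) x - pderiv (i + 2) (fun y => u t y (i + 1)) x := rfl
  -- the plane facts (§1)
  have hud : Differentiable ℝ (u t) := (hu ht).differentiable (by simp)
  have hz1 : pderiv (i + 1) (fun y => u t y i) x = 0 :=
    pderiv_of_ne_apply_same_eq_zero (hsym t ht) hud hki hx
  have hz2 : pderiv (i + 2) (fun y => u t y i) x = 0 :=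
    pderiv_of_ne_apply_same_eq_zero (hsym t ht) hud hli hx
  have hu0 : u t x i = 0 := apply_same_eq_zero (hsym t ht) hx
  -- the tree's vorticity transport identity with the empty word
  have hv := h.vorticity_transport_forced hS hcl ht x (Fin.elim0 : Fin 0 → Fin 3) (i + 1) (i + 2)
  simp only [ipderiv_zero, ipderiv_cons, hexp] at hv
  rw [sum_univ_fin_three_rot _ i, sum_univ_fin_three_rot _ i, sum_univ_fin_three_rot _ i,
    hz1, hz2, hu0] at hv
  rw [hT, hF]
  simp only [hcv t ht]
  rw [sum_univ_erase_fin_three, hexp2, hexp2, hΩx, sum_univ_fin_three_rot _ i]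
  linear_combination hv

/-- **The flux law for the normal vorticity of a fixed mirror-plane rectangle (rate form).**
In the setting of `mirrorPlane_vorticity_eq`, integrate over the plane
rectangle `R = P([a₁,b₁] × [a₂,b₂])` (chart `P (s,t) = s e_{i+1} + t e_{i+2}`):
`∫_R ∂ₜωᵢ = ν ∫_R ∑ⱼ∂ⱼ∂ⱼ ωᵢ − ∮_{∂R} ωᵢ (u · n_out) + ∫_R (curl f)ᵢ`,
the edge term being `[∫ u_{i+2} ωᵢ ds]_{t=a₂}^{t=b₂} + [∫ u_{i+1} ωᵢ dt]_{s=a₁}^{s=b₁}` (Green's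
formula of §3). In words: apart from viscous diffusion (and the curl of the force), the
normal-vorticity content of a FIXED region of a symmetry plane changes only by transport of `ωᵢ`
across the region's edge by the in-plane velocity, i.e. by material points of the invariant plane
crossing the edge. If the plane's material points only LEAVE the region where `ωᵢ` is co-signed
(`setIntegral_sum_pderiv_mul_nonneg_of_outflow`), the inviscid unforced budget of `∫_R ωᵢ` is
non-positive: any gain of co-signed normal flux through a fixed plane region must then be viscous. -/
theorem setIntegral_mirrorPlane_vorticity_eq
    {i : Fin 3} (h : IsClassicalNSSolutionOn S ν f u p) (hS : UniqueDiffOn ℝ S)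
    (hcl : S ⊆ closure (interior S))
    (hsym : ∀ s ∈ S, ∀ x, u s (reflC i x) = reflC i (u s x))
    {t : ℝ} (ht : t ∈ S)
    {P : ℝ × ℝ → EuclideanSpace ℝ (Fin 3)}
    (hP : ∀ q, P q = q.1 • (stdVec (i + 1) : EuclideanSpace ℝ (Fin 3)) + q.2 • stdVec (i + 2))
    {a b : ℝ × ℝ} (hab : a ≤ b) :
    ∫ q in Icc a b, Literature.Analysis.FluidPDE.timeDerivWithin S (fun s y => curl (u s) y i) t (P q) =
      ν * (∫ q in Icc a b, ∑ j, pderiv j (pderiv j fun y => curl (u t) y i) (P q)) -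
        ((((∫ s in a.1..b.1, u t (P (s, b.2)) (i + 2) * curl (u t) (P (s, b.2)) i) -
            ∫ s in a.1..b.1, u t (P (s, a.2)) (i + 2) * curl (u t) (P (s, a.2)) i) +
          ∫ r in a.2..b.2, u t (P (b.1, r)) (i + 1) * curl (u t) (P (b.1, r)) i) -
        ∫ r in a.2..b.2, u t (P (a.1, r)) (i + 1) * curl (u t) (P (a.1, r)) i) +
      ∫ q in Icc a b, curl (f t) (P q) i := by
  have hut : ContDiff ℝ ∞ (u t) := h.contDiff_velocity ht
  have hu1 : ContDiff ℝ 1 (u t) := hut.of_le (by exact_mod_cast le_top)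
  have hcurlI : ContDiff ℝ ∞ (curl (u t)) := contDiff_curl (n := (⊤ : ℕ∞)) (hut.of_le (by simp))
  have hcurl1 : ContDiff ℝ 1 (curl (u t)) := hcurlI.of_le (by exact_mod_cast le_top)
  have hΩ : ContDiff ℝ ∞ fun y => curl (u t) y i := contDiff_euclidean.1 hcurlI i
  have hPc : Continuous P := by
    have : P = fun q => q.1 • (stdVec (i + 1) : EuclideanSpace ℝ (Fin 3)) + q.2 • stdVec (i + 2) :=
      funext hP
    rw [this]; fun_prop
  -- continuity (hence integrability on the compact rectangle) of the three pieces
  have hLc : Continuous fun q : ℝ × ℝ => ∑ j, pderiv j (pderiv j fun y => curl (u t) y i) (P q) := by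
    refine continuous_finsetSum _ fun j _ => ?_
    exact ((contDiff_pderiv (contDiff_pderiv hΩ j) j).continuous).comp hPc
  have hDc : Continuous fun q : ℝ × ℝ =>
      ∑ j ∈ Finset.univ.erase i, pderiv j (fun y => u t y j * curl (u t) y i) (P q) := by
    refine continuous_finsetSum _ fun j _ => ?_
    exact (contDiff_pderiv ((h.contDiff_comp ht j).mul hΩ) j).continuous.comp hPc
  have hFc : Continuous fun q : ℝ × ℝ => curl (f t) (P q) i := by
    have hcf : Continuous (curl (f t)) :=
      continuous_curl ((h.contDiff_force hS ht).of_le (by exact_mod_cast le_top))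
    have : (fun q : ℝ × ℝ => curl (f t) (P q) i) =
        (EuclideanSpace.proj i : EuclideanSpace ℝ (Fin 3) →L[ℝ] ℝ) ∘ curl (f t) ∘ P := rfl
    rw [this]
    exact (EuclideanSpace.proj i).continuous.comp (hcf.comp hPc)
  have hLi : IntegrableOn (fun q : ℝ × ℝ => ν * ∑ j, pderiv j (pderiv j fun y => curl (u t) y i) (P q))
      (Icc a b) := (continuous_const.mul hLc).continuousOn.integrableOn_compact isCompact_Icc
  have hDi : IntegrableOn (fun q : ℝ × ℝ =>
      ∑ j ∈ Finset.univ.erase i, pderiv j (fun y => u t y j * curl (u t) y i) (P q)) (Icc a b) :=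
    hDc.continuousOn.integrableOn_compact isCompact_Icc
  have hFi : IntegrableOn (fun q : ℝ × ℝ => curl (f t) (P q) i) (Icc a b) :=
    hFc.continuousOn.integrableOn_compact isCompact_Icc
  have hLDi : Integrable (fun q : ℝ × ℝ =>
      ν * ∑ j, pderiv j (pderiv j fun y => curl (u t) y i) (P q) -
        ∑ j ∈ Finset.univ.erase i, pderiv j (fun y => u t y j * curl (u t) y i) (P q))
      (volume.restrict (Icc a b)) := hLi.sub hDi
  -- the pointwise law on the plane, integrated
  rw [setIntegral_congr_fun measurableSet_Icc (fun q _ =>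
    mirrorPlane_vorticity_eq h hS hcl hsym ht (planeChart_apply_same i hP q)),
    integral_add hLDi hFi, integral_sub hLi hDi, integral_const_mul,
    setIntegral_sum_pderiv_mul_eq_edges i hu1 hcurl1 hP hab]

end Solutions

end Summit.NavierStokesRegularity.FluidComputer.SymmetryPlaneFluxLaw
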